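import Summits.QuantumFields.BalabanUV.Beta.D1BFx.PackedCoframePairMass
import Summits.QuantumFields.BalabanUV.Beta.D1BFx.PackedNSideReadout
import Summits.QuantumFields.BalabanUV.Beta.D1BFx.PackedColumnTableMass
import Summits.QuantumFields.BalabanUV.Beta.D1BFx.RestKernelSandwichLoc

/-!
# BetaPertH road «BF-x» — «COFRAME-MASS ROAD» M3: the `z`-decay mass letters of the road's second-order N table `W2NInf`, block by block, per scale

STATUS: [folklore] `ℓ¹` bookkeeping for the road's (A1)-PACKED identity (BINDER row D1, slot (K)); NOT an estimate of Bałaban's, NOT a discharge of any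
root-level binder.  Provenance: reconstruction; the manuscript(s) under audit are NOT citable.

WHAT (`n = m+1`, `G₀ := coDressKBmAt (toSite r) n (KInvStep n 0)`, `r ∈ box 4 n`):
* §1 [folklore] **`exists_mass_cofPairInf_road`** — M2's `exists_mass_cofPairInf` AT THE ROAD's WEIGHTS `colH G₀ n μ y`, `colH G₀ n ν y′` (envelope:
  gan24-leaf-05 `PackedColumnEnvelope.abs_colH_G₀_road_le`; kernel letters: `KGhostLeg.decays_Cgh` (`∃ C`), `TorusWeightWordArrays.decays_Rgt_dB`, at the common
  rate `min (κ′∕(4n)) (dB n a∕8)`): `∃ KN κN, 0 < κN ∧ ∀ y y′, Summable ∧ mass ≤ KN·e^{−κN·|y−y′|₁}` — PER SCALE `m` (the constants' n-dependence is NOT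
  displayed; this is the qualitative ∕ `hMR`-grade letter, honest).
* §2 [folklore] the blocks of `W2NInf` (READ-OUT): `blk (W2NInf …) j true = blk (W2litInf …) j true + [j]·cofPairInf …`, `blk (W2NInf …) j false = −blk (W2litInf …) j false`;
  the literal table IS `vertex2OfK G₀ n S₂` (PART 3a `vertex2OfK_eq_sliceSum`) whose block masses are gan24-leaf-05's «G0-TABLE-MASS»
  `PackedColumnTableMass.mass_blk_vertex2OfK_G₀_le` (pair letters from the literal's `LocStencil₂` body by leaf-01's `mass_blk_le_of_body`);
  **`exists_mass_blk_W2NInf`**: `∃ mW κ, 0 < κ ∧ ∀ y y′ j i, Summable ∧ Σ'|blk (W2NInf m a r S₂ μ y ν y′) j i| ≤ mW j i·e^{−κ·|y′−y|₁}` — the SHAPE of PART 12b's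
  `hWs∕hWm` (`RoadEndBFxRoadS`, owner d1-p2 g19) AT FIXED `m` (`y := 0`: `exists_mass_blk_W2NInf_zero`).  PART 12b quantifies `∀ m` with ONE `mW`: that
  m-UNIFORM letter needs the n-explicit count of the co-frame words (block-scale envelopes, not the `ℓ¹` `Zl`-currency of M1–M2) and is NOT claimed here.
Unit `b2b-balaban-beta-d1-formalise-leaf-03` (gen 24); road owner `b2b-balaban-beta-d1-p2`.
-/

noncomputable section

namespace Summit.QuantumFields.BalabanUV.Beta.D1BFx.PackedCoframeMassRoad

open scoped BigOperators
open Literature.MathematicalPhysics.QuantumFieldTheory.Balaban1983to89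
open Literature.MathematicalPhysics.QuantumFieldTheory.Balaban1983to89.Beta
open B12Sec2to5 (l1 l1_nonneg)
open B5Hk163Strip (kappa163 kappa163_pos)
open ExpKernelCalculus (Site MKer BiLoc Decays Zl l1_sub_symm l1_natSmul)
open AffineAveraging (box toSite)
open OneStepResolventKernel (Fib)
open OneStepKernelFamily (colH KInvStep)
open SecondOrderResponse (vertex2OfK)
open Summit.QuantumFields.BalabanUV.Beta.TameKernelCalculus (decays_of_le)
open Summit.QuantumFields.BalabanUV.Beta.AxialDressingRooted (coDressKBmAt decays_coDressKBmAt_KInvStep)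
open Summit.QuantumFields.BalabanUV.Beta.D1BFx.PackedKernelSplit (blk blk_tt)
open Summit.QuantumFields.BalabanUV.Beta.D1BFx.KGhostLeg (Cgh decays_Cgh deltaCgh)
open Summit.QuantumFields.BalabanUV.Beta.D1BFx.RJetProjector (Rgt)
open Summit.QuantumFields.BalabanUV.Beta.D1BFx.TorusBondArrays (dB dB_pos)
open Summit.QuantumFields.BalabanUV.Beta.D1BFx.TorusWeightWordArrays (decays_Rgt_dB)
open Summit.QuantumFields.BalabanUV.Beta.D1BFx.GhostStencil (l1_zero)
open Summit.QuantumFields.BalabanUV.Beta.D1BFx.PeriodicArrayWrapLimit (weight_mono)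
open Summit.QuantumFields.BalabanUV.Beta.D1BFx.PackedSortedBridges (embFF twistR twistR_inl twistR_inr embFF_inl_inl embFF_inl_inr embFF_inr_inl embFF_inr_inr)
open Summit.QuantumFields.BalabanUV.Beta.D1BFx.PackedLettersAtSites (vertex2OfK_eq_sliceSum)
open Summit.QuantumFields.BalabanUV.Beta.D1BFx.PackedColumnEnvelope (abs_colH_G₀_road_le)
open Summit.QuantumFields.BalabanUV.Beta.D1BFx.PackedColumnTableMass (mass_blk_vertex2OfK_G₀_le)
open Summit.QuantumFields.BalabanUV.Beta.D1BFx.RestKernelSandwichLoc (mass_blk_le_of_body)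
open Summit.QuantumFields.BalabanUV.Beta.D1BFx.PackedCoframePairLimit (cofPairInf)
open Summit.QuantumFields.BalabanUV.Beta.D1BFx.PackedNSidePair (W2litInf W2NInf)
open Summit.QuantumFields.BalabanUV.Beta.D1BFx.PackedCoframeSep (mass_add_le mass_neg_eq)
open Summit.QuantumFields.BalabanUV.Beta.D1BFx.PackedCoframePairMass (exists_mass_cofPairInf)

variable (m : ℕ) {a : ℝ} {r : Fin (3 + 1) → ℕ}

/-! ## §1 The co-frame pair table at the road's weights -/

/-- [folklore] **«COFRAME-MASS» AT THE ROAD's WEIGHTS, PER SCALE**: `∃ KN κN, 0 < κN ∧ ∀ y y′,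
Σ'|cofPairInf (m+1) a (colH G₀ (m+1) μ y) (colH G₀ (m+1) ν y′)| ≤ KN·e^{−κN·|y−y′|₁}` (and summable). -/
theorem exists_mass_cofPairInf_road (ha : 0 < a) (hr : r ∈ box (3 + 1) (m + 1)) (μ ν : Fin 4) :
    ∃ KN κN : ℝ, 0 < κN ∧ ∀ (y y' : Fin 4 → ℤ),
      (Summable fun pq : Site 4 × Site 4 => ∑ α, ∑ β,
        |cofPairInf (m + 1) a (colH (coDressKBmAt (toSite r) (m + 1) (KInvStep (d := 3) (m + 1) 0)) (m + 1) μ y)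
          (colH (coDressKBmAt (toSite r) (m + 1) (KInvStep (d := 3) (m + 1) 0)) (m + 1) ν y') pq.1 pq.2 α β|) ∧
      ∑' pq : Site 4 × Site 4, ∑ α, ∑ β,
        |cofPairInf (m + 1) a (colH (coDressKBmAt (toSite r) (m + 1) (KInvStep (d := 3) (m + 1) 0)) (m + 1) μ y)
          (colH (coDressKBmAt (toSite r) (m + 1) (KInvStep (d := 3) (m + 1) 0)) (m + 1) ν y') pq.1 pq.2 α β|
        ≤ KN * Real.exp (-κN * l1 (y - y')) := by
  obtain ⟨CC, hCC⟩ := decays_Cgh (m + 1) a ha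
  have hd := dB_pos (m + 1) a ha
  have hn : (0 : ℝ) < ((m + 1 : ℕ) : ℝ) := by exact_mod_cast Nat.succ_pos m
  have hκ := kappa163_pos 4
  set δ₀ : ℝ := min (kappa163 4 / 4 / (4 * ((m + 1 : ℕ) : ℝ))) (dB (m + 1) a / 8) with hδ₀
  have hδ₀pos : 0 < δ₀ := lt_min (by positivity) (by linarith)
  have hδ₀w : δ₀ ≤ kappa163 4 / 4 / (4 * ((m + 1 : ℕ) : ℝ)) := min_le_left _ _
  have hδ₀B : δ₀ ≤ dB (m + 1) a / 8 := min_le_right _ _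
  have hB1 : dB (m + 1) a ≤ 1 := min_le_left _ _
  have hBC : dB (m + 1) a ≤ deltaCgh (m + 1) a := min_le_right _ _
  have hδ₀1 : δ₀ ≤ 1 := by linarith
  have hG : Decays (Cgh (m + 1) a) (|CC|) δ₀ := decays_of_le hCC (by linarith)
  have hR : Decays (Rgt (m + 1) a) _ δ₀ := decays_of_le (decays_Rgt_dB m ha) hδ₀B
  obtain ⟨K, hK⟩ := exists_mass_cofPairInf hG hR hδ₀pos hδ₀1
    ((((m + 1 : ℕ) : ℝ) ^ 4)⁻¹ * ((B5Hk163Decay.MG163 4 * B4TorusKernel.periodConst (kappa163 4) 3)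
      * (1 + 8 * (1 + Real.exp (kappa163 4 / 4))) * Real.exp (kappa163 4 / 4)))
    ((((m + 1 : ℕ) : ℝ) ^ 4)⁻¹ * ((B5Hk163Decay.MG163 4 * B4TorusKernel.periodConst (kappa163 4) 3)
      * (1 + 8 * (1 + Real.exp (kappa163 4 / 4))) * Real.exp (kappa163 4 / 4)))
  refine ⟨K, δ₀ / 32 * ((m + 1 : ℕ) : ℝ), by positivity, fun y y' => ?_⟩
  have hw : ∀ κ u, |colH (coDressKBmAt (toSite r) (m + 1) (KInvStep (d := 3) (m + 1) 0)) (m + 1) μ y κ u|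
      ≤ _ * Real.exp (-δ₀ * l1 (u - ((m + 1 : ℕ) : ℤ) • y)) := fun κ u => weight_mono (abs_colH_G₀_road_le m hr μ y κ) hδ₀w u
  have hw' : ∀ κ u, |colH (coDressKBmAt (toSite r) (m + 1) (KInvStep (d := 3) (m + 1) 0)) (m + 1) ν y' κ u|
      ≤ _ * Real.exp (-δ₀ * l1 (u - ((m + 1 : ℕ) : ℤ) • y')) := fun κ u => weight_mono (abs_colH_G₀_road_le m hr ν y' κ) hδ₀w u
  have h := hK _ _ _ _ hw hw'
  rw [← smul_sub, l1_natSmul] at h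
  refine ⟨h.1, h.2.trans_eq ?_⟩
  congr 1
  congr 1
  ring

/-! ## §2 The blocks of `W2NInf` and their masses -/

section Blocks

variable {m} (a) (r) (S₂ : Fin 4 → (Fin 4 → ℤ) → Fin 4 → (Fin 4 → ℤ) → MKer 4 (Fib 3))

/-- [our object] Field columns: `blk (W2NInf …) j true = blk (W2litInf …) j true + blk (embFF (cofPairInf …)) j true`. -/
theorem blk_W2NInf_inl (μ : Fin 4) (y : Fin 4 → ℤ) (ν : Fin 4) (y' : Fin 4 → ℤ) (j : Bool) :
    blk (W2NInf m a r S₂ μ y ν y') j true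
      = blk (W2litInf m r S₂ μ y ν y') j true
        + blk (embFF (cofPairInf (m + 1) a (colH (coDressKBmAt (toSite r) (m + 1) (KInvStep (d := 3) (m + 1) 0)) (m + 1) μ y)
            (colH (coDressKBmAt (toSite r) (m + 1) (KInvStep (d := 3) (m + 1) 0)) (m + 1) ν y'))) j true := by
  funext x z α β
  cases j <;> simp [blk, PackedKernelSplit.inj, W2NInf, twistR_inl]

/-- [our object] Multiplier columns: `blk (W2NInf …) j false = −blk (W2litInf …) j false` (the sign twist; `embFF` has no multiplier column). -/
theorem blk_W2NInf_inr (μ : Fin 4) (y : Fin 4 → ℤ) (ν : Fin 4) (y' : Fin 4 → ℤ) (j : Bool) :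
    blk (W2NInf m a r S₂ μ y ν y') j false = -blk (W2litInf m r S₂ μ y ν y') j false := by
  funext x z α β
  cases j <;> simp [blk, PackedKernelSplit.inj, W2NInf, twistR_inr, embFF_inl_inr, embFF_inr_inr]

/-- [our object] The embedded co-frame block: `tt` is the table, the other three vanish. -/
theorem blk_embFF (K : MKer 4 (Fin 4)) (j i : Bool) :
    blk (embFF K) j i = (if j = true ∧ i = true then K else 0) := by
  funext x z α β
  cases j <;> cases i <;> simp [blk, PackedKernelSplit.inj, embFF_inl_inl, embFF_inl_inr, embFF_inr_inl, embFF_inr_inr]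

end Blocks

/-- [folklore] **THE BLOCK MASSES OF THE ROAD's SECOND-ORDER N TABLE, PER SCALE** (the shape of PART 12b's `hWs`∕`hWm` at fixed `m`):
`∃ mW κ, 0 < κ ∧ ∀ y y′ j i, Summable ∧ Σ'_{(x,x′)} Σ_{g f} |blk (W2NInf m a r S₂ μ y ν y′) j i x x′ g f| ≤ mW j i·e^{−κ·|y′−y|₁}` for a pair-stencil family with the
literal's `LocStencil₂` body. -/
theorem exists_mass_blk_W2NInf (ha : 0 < a) (hr : r ∈ box (3 + 1) (m + 1))
    {S₂ : Fin 4 → (Fin 4 → ℤ) → Fin 4 → (Fin 4 → ℤ) → MKer 4 (Fib 3)} {Ck δ₂ : ℝ}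
    (hS₂ : ∀ κ u κ' u', BiLoc (S₂ κ u κ' u') u u (Ck * Real.exp (-δ₂ * l1 (u' - u))) δ₂) (hCk : 0 ≤ Ck) (hδ₂ : 0 < δ₂)
    (μ ν : Fin 4) :
    ∃ (mW : Bool → Bool → ℝ) (κ : ℝ), 0 < κ ∧ ∀ (y y' : Fin 4 → ℤ) (j i : Bool),
      (Summable fun q : Site 4 × Site 4 => ∑ g, ∑ f, |blk (W2NInf m a r S₂ μ y ν y') j i q.1 q.2 g f|) ∧
      ∑' q : Site 4 × Site 4, ∑ g, ∑ f, |blk (W2NInf m a r S₂ μ y ν y') j i q.1 q.2 g f| ≤ mW j i * Real.exp (-κ * l1 (y' - y)) := by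
  -- the literal table is `vertex2OfK G₀ n S₂`
  obtain ⟨δG, CG, hδG, hCG, hG⟩ := decays_coDressKBmAt_KInvStep (d := 3) hr 0
  set δ' : ℝ := min δ₂ δG with hδ'
  have hδ'pos : 0 < δ' := lt_min hδ₂ hδG
  have hS₂' : ∀ κ u κ' u', BiLoc (S₂ κ u κ' u') u u (Ck * Real.exp (-δ' * l1 (u' - u))) δ' := fun κ u κ' u' x z c b =>
    (hS₂ κ u κ' u' x z c b).trans (mul_le_mul (mul_le_mul_of_nonneg_left (Real.exp_le_exp.mpr
      (by nlinarith [l1_nonneg (u' - u), min_le_left δ₂ δG])) hCk)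
      (Real.exp_le_exp.mpr (by nlinarith [l1_nonneg (x - u), l1_nonneg (z - u), min_le_left δ₂ δG])) (Real.exp_pos _).le
      (mul_nonneg hCk (Real.exp_pos _).le))
  have hlit : ∀ y y', W2litInf m r S₂ μ y ν y'
      = vertex2OfK (coDressKBmAt (toSite r) (m + 1) (KInvStep (d := 3) (m + 1) 0)) (m + 1) S₂ μ y ν y' := fun y y' => by
    rw [vertex2OfK_eq_sliceSum (N := m + 1) hG hCG hS₂' hCk hδ'pos (min_le_right _ _)]; rfl
  -- the literal block masses (gan24-leaf-05) from the body letters (leaf-01)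
  have hT := fun κ u κ' u' j i => mass_blk_le_of_body hS₂ hCk hδ₂ κ u κ' u' j i
  have hV := fun y y' j i => mass_blk_vertex2OfK_G₀_le m hr hδ₂ (fun κ u κ' u' j i => (hT κ u κ' u' j i).1)
    (fun κ u κ' u' j i => (hT κ u κ' u' j i).2) μ y ν y' j i
  -- the co-frame block
  obtain ⟨KN, κN, hκN, hN⟩ := exists_mass_cofPairInf_road m ha hr μ ν
  set ML : ℝ := 16 * ((B5Hk163Decay.MG163 4 * B4TorusKernel.periodConst (kappa163 4) 3) * (1 + 8 * (1 + Real.exp (kappa163 4 / 4)))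
      * Real.exp (kappa163 4 / 4)) ^ 2 * (1 + 16 / (kappa163 4 / 4)) ^ 4 * Zl 4 (δ₂ / 2) * ((((m + 1 : ℕ) : ℝ)) ^ 4)⁻¹
      * (16 * Ck * Zl 4 (δ₂ / 2) ^ 2) with hML
  set κ₀ : ℝ := min (min (kappa163 4 / 4 / 8) (δ₂ / 2)) κN with hκ₀
  have hκ₀pos : 0 < κ₀ := lt_min (lt_min (by have := kappa163_pos 4; positivity) (half_pos hδ₂)) hκN
  have hML0 : 0 ≤ ML := by
    have h := (hV 0 0 true true).2
    have h0 : 0 ≤ ∑' q : Site 4 × Site 4, ∑ g, ∑ f, |blk (vertex2OfK (coDressKBmAt (toSite r) (m + 1) (KInvStep (d := 3) (m + 1) 0))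
        (m + 1) S₂ μ 0 ν 0) true true q.1 q.2 g f| :=
      tsum_nonneg fun q => Finset.sum_nonneg fun g _ => Finset.sum_nonneg fun f _ => abs_nonneg _
    rw [sub_self, l1_zero, mul_zero, Real.exp_zero, mul_one] at h
    exact h0.trans h
  have hKN0 : 0 ≤ KN := by
    have h := (hN 0 0).2
    rw [sub_self, l1_zero, mul_zero, Real.exp_zero, mul_one] at h
    exact (tsum_nonneg fun q => Finset.sum_nonneg fun g _ => Finset.sum_nonneg fun f _ => abs_nonneg _).trans h
  refine ⟨fun j i => ML + (if j = true ∧ i = true then KN else 0), κ₀, hκ₀pos, fun y y' j i => ?_⟩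
  have eL : Real.exp (-(min (kappa163 4 / 4 / 8) (δ₂ / 2)) * l1 (y' - y)) ≤ Real.exp (-κ₀ * l1 (y' - y)) :=
    Real.exp_le_exp.mpr (by nlinarith [l1_nonneg (y' - y), min_le_left (min (kappa163 4 / 4 / 8) (δ₂ / 2)) κN])
  have eN : Real.exp (-κN * l1 (y - y')) ≤ Real.exp (-κ₀ * l1 (y' - y)) := by
    rw [l1_sub_symm y y']
    exact Real.exp_le_exp.mpr (by nlinarith [l1_nonneg (y' - y), min_le_right (min (kappa163 4 / 4 / 8) (δ₂ / 2)) κN])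
  have mL := hV y y' j i
  rw [← hlit] at mL
  have bL : ∑' q : Site 4 × Site 4, ∑ g, ∑ f, |blk (W2litInf m r S₂ μ y ν y') j i q.1 q.2 g f| ≤ ML * Real.exp (-κ₀ * l1 (y' - y)) :=
    mL.2.trans (mul_le_mul_of_nonneg_left eL hML0)
  cases i with
  | false =>
    rw [blk_W2NInf_inr, mass_neg_eq]
    refine ⟨mL.1, bL.trans ?_⟩
    simp only [and_false, if_false, add_zero, le_refl, Bool.false_eq_true]
  | true =>
    have mN := hN y y'
    have bN := mN.2.trans (mul_le_mul_of_nonneg_left eN hKN0)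
    rw [blk_W2NInf_inl, blk_embFF]
    cases j with
    | false =>
      simp only [Bool.false_eq_true, false_and, if_false, add_zero]
      exact ⟨mL.1, bL⟩
    | true =>
      simp only [and_self, if_true]
      have s := mass_add_le mL.1 mN.1
      refine ⟨s.1, s.2.trans ?_⟩
      nlinarith [bL, bN]

/-- [folklore] **THE SAME AT THE BASE BOND `(μ, 0)`** — PART 12b's `hWs`∕`hWm` shape at fixed `m`: `… ≤ mW j i·e^{−κ·|z|₁}`. -/
theorem exists_mass_blk_W2NInf_zero (ha : 0 < a) (hr : r ∈ box (3 + 1) (m + 1))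
    {S₂ : Fin 4 → (Fin 4 → ℤ) → Fin 4 → (Fin 4 → ℤ) → MKer 4 (Fib 3)} {Ck δ₂ : ℝ}
    (hS₂ : ∀ κ u κ' u', BiLoc (S₂ κ u κ' u') u u (Ck * Real.exp (-δ₂ * l1 (u' - u))) δ₂) (hCk : 0 ≤ Ck) (hδ₂ : 0 < δ₂)
    (μ ν : Fin 4) :
    ∃ (mW : Bool → Bool → ℝ) (κ : ℝ), 0 < κ ∧ ∀ (z : Fin 4 → ℤ) (j i : Bool),
      (Summable fun q : Site 4 × Site 4 => ∑ g, ∑ f, |blk (W2NInf m a r S₂ μ 0 ν z) j i q.1 q.2 g f|) ∧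
      ∑' q : Site 4 × Site 4, ∑ g, ∑ f, |blk (W2NInf m a r S₂ μ 0 ν z) j i q.1 q.2 g f| ≤ mW j i * Real.exp (-κ * l1 z) := by
  obtain ⟨mW, κ, hκ, h⟩ := exists_mass_blk_W2NInf m ha hr hS₂ hCk hδ₂ μ ν
  exact ⟨mW, κ, hκ, fun z j i => by simpa only [sub_zero] using h 0 z j i⟩

end Summit.QuantumFields.BalabanUV.Beta.D1BFx.PackedCoframeMassRoad

end
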